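import Mathlib
import Literature.AlgebraicGeometry.Resolution.LogRegularScheme
import Literature.AlgebraicGeometry.Resolution.RegularLocalRingsProofs
import Literature.RingTheory.KrullDimension.AffineDimension
import Summits.ResolutionOfSingularities.ResolutionOfSingularities.Theorems.RadicialJungCleanModelsSufficeKummerOrderChart

/-!
# The Kummer order is logarithmically regular (Kato's condition (2.1) for the chart `Q_a`)

Let `A` be a regular local ring with fraction field `K` of characteristic `p`, `L ⊇ K` a field,
`y ∈ L` with `y ^ p = ∏_{i ≤ m} tᵢ ^ aᵢ` (`tᵢ ∈ A ∖ 0`, `a₀ = 1`, `1 ≤ aᵢ < p`), and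
`R = A[z_0, …, z_{p-1}] ⊆ L` the Kummer order, `z_j = y ^ j / ∏ᵢ tᵢ ^ ⌊j aᵢ / p⌋`. Let `S ≠ ∅`
index the `tᵢ` lying in the maximal ideal of `A`, and assume they are part of a regular system of
parameters (`A/(t_S)` regular of dimension `dim A - |S|`). For the saturated monoid
`P = {c ∈ ℤ^{m+1} | 0 ≤ c₀, 0 ≤ aᵢ c₀ + p cᵢ (i ≠ 0)}` and the chart
`φ(c) = y^{c₀} ∏_{i≠0} tᵢ^{cᵢ}`, `(R, φ)` is logarithmically regular in the sense of Kato (2.1)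
(`LogChart.IsLogRegularLocal`, theorem `stub_kummerOrderLogRegular`):

* by the factorisation `φ(c) = z_{c₀ mod p} · ∏ᵢ tᵢ ^ {eᵢ(c)}` of
  `RadicialJungCleanModelsSufficeKummerOrderChart.lean`, Kato's ideal is
  `I = (z_1, …, z_{p-1}) + (tᵢ : i ∈ S)` (units of `A` and the `z_j`, `j ≥ 1`, are told apart by
  Frobenius, `R ^ p ⊆ A`);
* `A → R/I` is surjective with kernel `(t_S)` (Frobenius again, and `A/(t_S)` is a domain), so
  `R/I ≅ A/(t_S)` is regular;
* the face of units spans the sublattice with basis `(p, -a_1, …, -a_m)` (if `0 ∉ S`) and `eᵢ`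
  (`i ∉ S`, `i ≠ 0`), of rank `m + 1 - |S|` (`kummer_finrank_span_face`), and `dim R = dim A`
  (`R` is integral over `A`), so `dim R = dim R/I + |S|`.

No use is made of the freeness of `R` over `A` nor of `[L : K] = p`.
-/

set_option linter.dupNamespace false -- the mandated summit namespace repeats a component

namespace Summit.ResolutionOfSingularities.ResolutionOfSingularities.Theorems.RadicialJung.CleanModelsSuffice

open Literature.AlgebraicGeometry.Resolution

/-! ### The lattice spanned by the face of units -/

section Lattice

variable {p m : ℕ} {a : Fin (m + 1) → ℕ} {B : Fin (m + 1) → Fin (m + 1) → ℤ}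
  {C : Fin p → Fin (m + 1) → ℤ}

/-- The vectors `B 0 = (p, -a_1, …, -a_m)` and `B i = eᵢ` (`i ≠ 0`) lie in `P`. -/
theorem kummerB_mem (hB : ∀ i k, B i k =
      if i = 0 then (if k = 0 then (p : ℤ) else -(a k : ℤ)) else if i = k then 1 else 0)
    (i : Fin (m + 1)) :
    0 ≤ B i 0 ∧ ∀ k, k ≠ 0 → 0 ≤ (a k : ℤ) * B i 0 + (p : ℤ) * B i k := by
  by_cases hi : i = 0
  · subst hi
    refine ⟨by simp [hB], fun k hk => ?_⟩
    simp only [hB, ↓reduceIte, if_neg hk]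
    linarith
  · refine ⟨by simp [hB, hi], fun k hk => ?_⟩
    simp only [hB, hi, ↓reduceIte, mul_zero, zero_add]
    split_ifs <;> simp

/-- The exponent vector of `φ(B i)` is `eᵢ`: `φ(B i) = z_0 · tᵢ`. -/
theorem kummerB_exp (hB : ∀ i k, B i k =
      if i = 0 then (if k = 0 then (p : ℤ) else -(a k : ℤ)) else if i = k then 1 else 0)
    (hp : p.Prime) (ha0 : a 0 = 1) (i k : Fin (m + 1)) :
    (((if k = i then 1 else 0 : ℕ)) : ℤ) =
      ((B i 0).toNat * a k / p : ℕ) + if k = 0 then 0 else B i k := by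
  by_cases hi : i = 0
  · subst hi
    by_cases hk : k = 0
    · subst hk
      simp [hB, ha0, hp.pos]
    · simp [hB, hk, Nat.mul_div_cancel_left _ hp.pos]
  · by_cases hk : k = 0
    · subst hk
      simp [hB, hi, Ne.symm hi]
    · simp only [hB, hi, ↓reduceIte, hk, Int.toNat_zero, Nat.zero_mul, Nat.zero_div,
        Nat.cast_zero, zero_add]
      by_cases hik : i = k
      · subst hik; simp
      · simp [hik, Ne.symm hik]

/-- `(B i)₀ ≡ 0 (mod p)`. -/
theorem kummerB_zero_mod (hB : ∀ i k, B i k =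
      if i = 0 then (if k = 0 then (p : ℤ) else -(a k : ℤ)) else if i = k then 1 else 0)
    (i : Fin (m + 1)) : (B i 0).toNat % p = 0 := by
  by_cases hi : i = 0 <;> simp [hB, hi]

/-- The vectors `C j = (j, -⌊j a_1 / p⌋, …, -⌊j a_m / p⌋)` lie in `P`. -/
theorem kummerC_mem
    (hC : ∀ j k, C j k = if k = 0 then ((j : ℕ) : ℤ) else -(((j : ℕ) * a k / p : ℕ) : ℤ))
    (j : Fin p) : 0 ≤ C j 0 ∧ ∀ k, k ≠ 0 → 0 ≤ (a k : ℤ) * C j 0 + (p : ℤ) * C j k := by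
  refine ⟨by simp [hC], fun k hk => ?_⟩
  simp only [hC, hk, ↓reduceIte, mul_neg]
  have := Nat.div_mul_le_self ((j : ℕ) * a k) p
  have h' : ((((j : ℕ) * a k / p : ℕ) : ℤ)) * p ≤ (j : ℕ) * a k := by exact_mod_cast this
  linarith

/-- The exponent vector of `φ(C j)` vanishes: `φ(C j) = z_j`. -/
theorem kummerC_exp
    (hC : ∀ j k, C j k = if k = 0 then ((j : ℕ) : ℤ) else -(((j : ℕ) * a k / p : ℕ) : ℤ))
    (ha0 : a 0 = 1) (j : Fin p) (k : Fin (m + 1)) :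
    (((0 : ℕ)) : ℤ) = ((C j 0).toNat * a k / p : ℕ) + if k = 0 then 0 else C j k := by
  by_cases hk : k = 0
  · subst hk
    simp [hC, ha0, Nat.div_eq_of_lt j.2]
  · simp [hC, hk]

/-- `(C j)₀ = j`. -/
theorem kummerC_zero_mod
    (hC : ∀ j k, C j k = if k = 0 then ((j : ℕ) : ℤ) else -(((j : ℕ) * a k / p : ℕ) : ℤ))
    (j : Fin p) : (C j 0).toNat % p = j := by
  simp [hC, Nat.mod_eq_of_lt j.2]

/-- Coordinates of an integral combination of the `B i`. -/
theorem kummerB_sum_apply (hB : ∀ i k, B i k =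
      if i = 0 then (if k = 0 then (p : ℤ) else -(a k : ℤ)) else if i = k then 1 else 0)
    (g : Fin (m + 1) → ℤ) (k : Fin (m + 1)) :
    (∑ i, g i • B i) k = if k = 0 then g 0 * p else g k - g 0 * a k := by
  rw [Finset.sum_apply, Fin.sum_univ_succ]
  simp only [Pi.smul_apply, smul_eq_mul, hB, ↓reduceIte, Fin.succ_ne_zero]
  refine Fin.cases ?_ (fun k' => ?_) k
  · simp
  · simp only [Fin.succ_ne_zero, ↓reduceIte, Fin.succ_inj, mul_ite, mul_one, mul_zero,
      Finset.sum_ite_eq', Finset.mem_univ]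
    ring

/-- The `B i` are linearly independent over `ℤ`. -/
theorem kummerB_linearIndependent (hB : ∀ i k, B i k =
      if i = 0 then (if k = 0 then (p : ℤ) else -(a k : ℤ)) else if i = k then 1 else 0)
    (hp : p.Prime) : LinearIndependent ℤ B := by
  refine Fintype.linearIndependent_iff.mpr fun g hg => ?_
  have h0 : g 0 = 0 := by
    have := congrFun hg 0
    rw [kummerB_sum_apply hB, if_pos rfl, Pi.zero_apply, mul_eq_zero] at this
    exact this.resolve_right (by exact_mod_cast hp.ne_zero)
  refine Fin.cases h0 (fun k => ?_)
  have := congrFun hg k.succ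
  rw [kummerB_sum_apply hB, if_neg (Fin.succ_ne_zero k), Pi.zero_apply, h0, zero_mul,
    sub_zero] at this
  exact this

/-- **Rank of the face of units.** If `U ⊆ ℤ^{m+1}` contains `B i` for `i ∉ S` and every
`u ∈ U` has `0 ≤ u₀ ≡ 0 (mod p)` and vanishing exponents `eᵢ(u)` for `i ∈ S`, then the `ℤ`-span
of `U` has rank `m + 1 - |S|` (it is the lattice with basis `B i`, `i ∉ S`). -/
theorem kummer_finrank_span_face (hB : ∀ i k, B i k =
      if i = 0 then (if k = 0 then (p : ℤ) else -(a k : ℤ)) else if i = k then 1 else 0)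
    (hp : p.Prime) (ha0 : a 0 = 1) (S : Finset (Fin (m + 1)))
    (U : Set (Fin (m + 1) → ℤ)) (hBU : ∀ i, i ∉ S → B i ∈ U)
    (hU : ∀ u ∈ U, 0 ≤ u 0 ∧ (u 0).toNat % p = 0 ∧
      ∀ i ∈ S, (((u 0).toNat * a i / p : ℕ) : ℤ) + (if i = 0 then 0 else u i) = 0) :
    Module.finrank ℤ (Submodule.span ℤ U) = m + 1 - S.card := by
  let b : {i : Fin (m + 1) // i ∉ S} → (Fin (m + 1) → ℤ) := B ∘ Subtype.val
  have hb : LinearIndependent ℤ b := (kummerB_linearIndependent hB hp).comp _ Subtype.val_injective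
  have hspan : Submodule.span ℤ U = Submodule.span ℤ (Set.range b) := by
    refine le_antisymm (Submodule.span_le.mpr fun u hu => ?_) (Submodule.span_mono ?_)
    · obtain ⟨hu0, hmod, hS⟩ := hU u hu
      set n := (u 0).toNat with hn_def
      have hn : (n : ℤ) = u 0 := Int.toNat_of_nonneg hu0
      have hpn : p ∣ n := Nat.dvd_of_mod_eq_zero hmod
      -- the coefficients
      let l : Fin (m + 1) → ℤ := fun k =>
        if k = 0 then ((n / p : ℕ) : ℤ) else u k + ((n / p : ℕ) : ℤ) * a k
      have hl : ∀ k ∈ S, l k = 0 := by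
        intro k hk
        have h := hS k hk
        by_cases hk0 : k = 0
        · subst hk0
          simp only [ha0, mul_one, ↓reduceIte, add_zero] at h
          have : n / p = 0 := by exact_mod_cast h
          simp [l, this]
        · simp only [if_neg hk0] at h
          rw [← Nat.div_mul_right_comm hpn, Nat.cast_mul] at h
          simp only [l, if_neg hk0]
          linarith
      have hsum : u = ∑ i, l i • B i := by
        funext k
        rw [kummerB_sum_apply hB]
        by_cases hk0 : k = 0
        · subst hk0
          simp only [l, ↓reduceIte]
          rw [← hn]
          exact_mod_cast (Nat.div_mul_cancel hpn).symm
        · simp only [l, if_neg hk0, ↓reduceIte]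
          ring
      rw [hsum]
      refine Submodule.sum_mem _ fun i _ => ?_
      by_cases hi : i ∈ S
      · rw [hl i hi, zero_smul]
        exact zero_mem _
      · exact Submodule.smul_mem _ _ (Submodule.subset_span ⟨⟨i, hi⟩, rfl⟩)
    · rintro _ ⟨⟨i, hi⟩, rfl⟩
      exact hBU i hi
  rw [hspan, finrank_span_eq_card hb, Fintype.card_subtype_compl, Fintype.card_fin,
    Fintype.card_coe]

end Lattice

/-! ### The theorem -/

/-- **The Kummer order is log regular for the chart `Q_a`** (Kato's condition (2.1)). Let `A` be a
regular local ring with fraction field `K` of characteristic `p`, `L/K` of degree `p`, `y ∈ L ∖ K`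
with `y^p = ∏_{i ≤ m} t_i^{a_i}`, `a₀ = 1`, `1 ≤ a_i < p`, `t_i ≠ 0`; suppose the `t_i` in the
maximal ideal (indexed by `S ≠ ∅`) are part of a regular system of parameters (`A/(t_S)` regular of
dimension `dim A - |S|`). For the saturated monoid `P = {c | 0 ≤ c₀, 0 ≤ a_i c₀ + p c_i (i ≠ 0)}`
and the chart `φ(c) = y^{c₀} ∏_{i≠0} t_i^{c_i}` into the Kummer order
`R = A[y^j / ∏ t_i^{⌊j a_i/p⌋} : j < p]`, `(R, φ)` is logarithmically regular: Kato's ideal is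
`(z₁, …, z_{p-1}) + (t_i : i ∈ S)` with `R/I ≅ A/(t_S)` regular, the face of units has corank
`|S|`, and `dim R = dim A = dim (A/(t_S)) + |S|`. -/
theorem stub_kummerOrderLogRegular {A K L : Type} [CommRing A] [IsRegularLocalRing A] [Field K]
    [Algebra A K] [IsFractionRing A K] [Field L] [Algebra K L] [Algebra A L] [IsScalarTower A K L]
    (p : ℕ) (hp : p.Prime) [CharP K p] (hdeg : Module.finrank K L = p) (m : ℕ)
    (t : Fin (m + 1) → A) (ht : ∀ i, t i ≠ 0) (a : Fin (m + 1) → ℕ) (ha0 : a 0 = 1)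
    (ha : ∀ i, 1 ≤ a i ∧ a i < p) (y : L) (hy : y ∉ Set.range (algebraMap K L))
    (hyp : y ^ p = algebraMap A L (∏ i, t i ^ a i))
    (S : Finset (Fin (m + 1))) (hS : ∀ i, i ∈ S ↔ t i ∈ IsLocalRing.maximalIdeal A)
    (hSne : S.Nonempty)
    (hreg : IsRegularLocalRing (A ⧸ Ideal.span (t '' (S : Set (Fin (m + 1))))))
    (hdim : ringKrullDim (A ⧸ Ideal.span (t '' (S : Set (Fin (m + 1))))) + (S.card : WithBot ℕ∞) =
      ringKrullDim A)
    (P : AddSubmonoid (Fin (m + 1) → ℤ))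
    (hP : ∀ c : Fin (m + 1) → ℤ, c ∈ P ↔
      0 ≤ c 0 ∧ ∀ i : Fin (m + 1), i ≠ 0 → 0 ≤ (a i : ℤ) * c 0 + (p : ℤ) * c i)
    (φ : Multiplicative P →*
      Algebra.adjoin A (Set.range fun j : Fin p =>
        y ^ (j : ℕ) / algebraMap A L (∏ i, t i ^ ((j : ℕ) * a i / p))))
    (hφ : ∀ c : P, ((φ (Multiplicative.ofAdd c) : Algebra.adjoin A (Set.range fun j : Fin p =>
        y ^ (j : ℕ) / algebraMap A L (∏ i, t i ^ ((j : ℕ) * a i / p)))) : L) =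
      y ^ ((c : Fin (m + 1) → ℤ) 0) *
        ∏ i ∈ Finset.univ.erase 0, algebraMap A L (t i) ^ ((c : Fin (m + 1) → ℤ) i)) :
    LogChart.IsLogRegularLocal P φ := by
  have _h₁ := hdeg
  have _h₂ := hy
  haveI : Fact p.Prime := ⟨hp⟩
  -- name the generators `z_j`
  revert φ
  generalize hz_def :
    (fun j : Fin p => y ^ (j : ℕ) / algebraMap A L (∏ i, t i ^ ((j : ℕ) * a i / p))) = z
  intro φ hφ
  have hz : ∀ j, z j = y ^ (j : ℕ) / algebraMap A L (∏ i, t i ^ ((j : ℕ) * a i / p)) :=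
    fun j => by rw [← hz_def]
  -- basic facts
  haveI := isDomain_of_isRegularLocalRing A
  have hinj : Function.Injective (algebraMap A L) := by
    rw [IsScalarTower.algebraMap_eq A K L]
    exact (algebraMap K L).injective.comp (IsFractionRing.injective A K)
  haveI : CharP L p := charP_of_injective_algebraMap (algebraMap K L).injective p
  have ht0 : ∀ i, algebraMap A L (t i) ≠ 0 := fun i => (map_ne_zero_iff _ hinj).mpr (ht i)
  have hne : ∀ e : Fin (m + 1) → ℕ, algebraMap A L (∏ i, t i ^ e i) ≠ 0 := fun e =>
    (map_ne_zero_iff _ hinj).mpr (Finset.prod_ne_zero_iff.mpr fun i _ => pow_ne_zero _ (ht i))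
  have hzp : ∀ j, ∃ b : A, z j ^ p = algebraMap A L b := fun j => ⟨_, kummer_z_pow hyp hz hne j⟩
  have hunit : ∀ i, ¬ IsUnit (t i) ↔ i ∈ S := fun i => by
    rw [hS i, IsLocalRing.mem_maximalIdeal, mem_nonunits_iff]
  obtain ⟨i₀, hi₀⟩ := hSne
  have hti₀ : ¬ IsUnit (t i₀) := (hunit i₀).mpr hi₀
  have hPmem : ∀ c : P, 0 ≤ (c : Fin (m + 1) → ℤ) 0 ∧
      ∀ i, i ≠ 0 → 0 ≤ (a i : ℤ) * (c : Fin (m + 1) → ℤ) 0 + (p : ℤ) * (c : Fin (m + 1) → ℤ) i :=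
    fun c => (hP c).mp c.2
  -- the special elements `B i ↦ tᵢ` and `C j ↦ z_j` of `P`
  obtain ⟨B, hB⟩ : ∃ B : Fin (m + 1) → Fin (m + 1) → ℤ, ∀ i k, B i k =
      if i = 0 then (if k = 0 then (p : ℤ) else -(a k : ℤ)) else if i = k then 1 else 0 :=
    ⟨fun i k => _, fun i k => rfl⟩
  obtain ⟨C, hC⟩ : ∃ C : Fin p → Fin (m + 1) → ℤ, ∀ j k, C j k =
      if k = 0 then ((j : ℕ) : ℤ) else -(((j : ℕ) * a k / p : ℕ) : ℤ) :=
    ⟨fun j k => _, fun j k => rfl⟩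
  have hBP : ∀ i, B i ∈ P := fun i => (hP _).mpr (kummerB_mem hB i)
  have hCP : ∀ j, C j ∈ P := fun j => (hP _).mpr (kummerC_mem hC j)
  have hφB : ∀ i, φ (Multiplicative.ofAdd ⟨B i, hBP i⟩) = algebraMap A _ (t i) := by
    intro i
    rw [kummer_factor_mk (c := B i) hp hyp hz hne ht0 (kummerB_mem hB i).1
      (kummerB_exp hB hp ha0 i) _ (hφ ⟨B i, hBP i⟩)]
    have hfin : (⟨(B i 0).toNat % p, Nat.mod_lt _ hp.pos⟩ : Fin p) = ⟨0, hp.pos⟩ :=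
      Fin.ext (kummerB_zero_mod hB i)
    have h1 : (⟨z ⟨(B i 0).toNat % p, Nat.mod_lt _ hp.pos⟩, Algebra.subset_adjoin ⟨_, rfl⟩⟩ :
        Algebra.adjoin A (Set.range z)) = 1 :=
      Subtype.ext (by rw [hfin]; exact kummer_z_zero hp hz)
    rw [h1, one_mul]
    congr 1
    rw [Finset.prod_eq_single i (fun k _ hk => by rw [if_neg hk, pow_zero]) (by simp)]
    simp
  have hφC : ∀ j, φ (Multiplicative.ofAdd ⟨C j, hCP j⟩) =
      ⟨z j, Algebra.subset_adjoin ⟨j, rfl⟩⟩ := by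
    intro j
    rw [kummer_factor_mk (c := C j) hp hyp hz hne ht0 (kummerC_mem hC j).1
      (kummerC_exp hC ha0 j) _ (hφ ⟨C j, hCP j⟩)]
    have hfin : (⟨(C j 0).toNat % p, Nat.mod_lt _ hp.pos⟩ : Fin p) = j :=
      Fin.ext (kummerC_zero_mod hC j)
    simp only [pow_zero, Finset.prod_const_one, map_one, mul_one]
    exact Subtype.ext (by rw [hfin])
  -- Kato's ideal `I = J := (z_1, …, z_{p-1}) + (tᵢ : i ∈ S)`
  obtain ⟨J, hJ⟩ : ∃ J : Ideal (Algebra.adjoin A (Set.range z)), J = Ideal.span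
      (((fun j : Fin p =>
          (⟨z j, Algebra.subset_adjoin ⟨j, rfl⟩⟩ : Algebra.adjoin A (Set.range z))) ''
            {j | (j : ℕ) ≠ 0}) ∪
        ((fun i => algebraMap A (Algebra.adjoin A (Set.range z)) (t i)) ''
          (S : Set (Fin (m + 1))))) :=
    ⟨_, rfl⟩
  have hJz : ∀ j : Fin p, (j : ℕ) ≠ 0 →
      (⟨z j, Algebra.subset_adjoin ⟨j, rfl⟩⟩ : Algebra.adjoin A (Set.range z)) ∈ J :=
    fun j hj => hJ ▸ Ideal.subset_span (Or.inl ⟨j, hj, rfl⟩)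
  have hJt : ∀ i, ¬ IsUnit (t i) → algebraMap A (Algebra.adjoin A (Set.range z)) (t i) ∈ J :=
    fun i hi => hJ ▸ Ideal.subset_span (Or.inr ⟨i, (hunit i).mp hi, rfl⟩)
  have hIJ : LogChart.nonunitIdeal P φ = J := by
    apply le_antisymm
    · refine Ideal.span_le.mpr ?_
      rintro _ ⟨c, hc, rfl⟩
      exact kummer_mem_of_not_isUnit hp hyp hz hne ht0 hJz hJt (hPmem c).1 (hPmem c).2 _
        (hφ c) hc
    · rw [hJ]
      refine Ideal.span_le.mpr ?_
      rintro _ (⟨j, hj, rfl⟩ | ⟨i, hi, rfl⟩)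
      · refine Ideal.subset_span ⟨⟨C j, hCP j⟩, ?_, hφC j⟩
        show ¬ IsUnit (φ (Multiplicative.ofAdd ⟨C j, hCP j⟩))
        rw [hφC j]
        exact kummer_not_isUnit_z hinj hyp hz hne hti₀ (ha i₀) hj
      · refine Ideal.subset_span ⟨⟨B i, hBP i⟩, ?_, hφB i⟩
        show ¬ IsUnit (φ (Multiplicative.ofAdd ⟨B i, hBP i⟩))
        rw [hφB i]
        exact fun h => (hunit i).mpr hi (kummer_isUnit_of_isUnit_algebraMap hinj hzp h)
  -- the face of units
  have hfin : Module.finrank ℤ (Submodule.span ℤ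
      ((fun c : P => (c : Fin (m + 1) → ℤ)) '' LogChart.unitFace P φ)) = m + 1 - S.card := by
    refine kummer_finrank_span_face hB hp ha0 S _ (fun i hi => ?_) ?_
    · refine ⟨⟨B i, hBP i⟩, ?_, rfl⟩
      show IsUnit (φ (Multiplicative.ofAdd ⟨B i, hBP i⟩))
      rw [hφB i]
      exact (not_not.mp fun h => hi ((hunit i).mp h)).map _
    · rintro _ ⟨c, hc, rfl⟩
      obtain ⟨e, he⟩ := kummer_exists_exp (a := a) hp (hPmem c).1 (hPmem c).2
      obtain ⟨hmod, hk⟩ := kummer_of_isUnit hinj hyp hz hne ht0 hti₀ (ha i₀) (hPmem c).1 he _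
        (hφ c) hc
      exact ⟨(hPmem c).1, hmod, fun i hi => by rw [← he i, hk i ((hunit i).mpr hi), Nat.cast_zero]⟩
  -- the quotient `R/J ≅ A/(t_S)`
  haveI := hreg
  have hsurj : Function.Surjective
      ((Ideal.Quotient.mk J).comp (algebraMap A (Algebra.adjoin A (Set.range z)))) := by
    intro q
    obtain ⟨x, rfl⟩ := Ideal.Quotient.mk_surjective q
    obtain ⟨b, hb⟩ := kummer_exists_sub_mem hp hz hJz x
    exact ⟨b, (Ideal.Quotient.eq.mpr hb).symm⟩
  have hker : RingHom.ker ((Ideal.Quotient.mk J).comp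
      (algebraMap A (Algebra.adjoin A (Set.range z)))) =
      Ideal.span (t '' (S : Set (Fin (m + 1)))) := by
    apply le_antisymm
    · intro b hb
      rw [RingHom.mem_ker, RingHom.comp_apply, Ideal.Quotient.eq_zero_iff_mem, hJ] at hb
      obtain ⟨b', hb', he⟩ : ∃ b' ∈ Ideal.span (t '' (S : Set (Fin (m + 1)))),
          ((algebraMap A (Algebra.adjoin A (Set.range z)) b : _) : L) ^ p = algebraMap A L b' :=
        kummer_pow_mem_of_mem_span hzp (fun g hg => by
          rcases hg with ⟨j, hj, rfl⟩ | ⟨i, hi, rfl⟩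
          · obtain ⟨w, hw⟩ := kummer_dvd_prod_mod (t := t) hp hj j.2 (ha i₀)
            refine ⟨_, ?_, kummer_z_pow hyp hz hne j⟩
            rw [hw]
            exact Ideal.mul_mem_right _ _ (Ideal.subset_span ⟨i₀, hi₀, rfl⟩)
          · exact ⟨t i ^ p, Ideal.pow_mem_of_mem (Ideal.span (t '' (S : Set (Fin (m + 1)))))
              (Ideal.subset_span (Set.mem_image_of_mem t hi)) p hp.pos, by simp⟩) hb
      have hprime : (Ideal.span (t '' (S : Set (Fin (m + 1))))).IsPrime :=
        (Ideal.Quotient.isDomain_iff_prime _).mp (isDomain_of_isRegularLocalRing _)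
      refine hprime.mem_of_pow_mem p ?_
      have : b ^ p = b' := hinj (by rw [map_pow, ← he]; simp)
      rwa [this]
    · rw [Ideal.span_le]
      rintro _ ⟨i, hi, rfl⟩
      rw [SetLike.mem_coe, RingHom.mem_ker, RingHom.comp_apply, Ideal.Quotient.eq_zero_iff_mem]
      exact hJt i ((hunit i).mpr hi)
  let e : (A ⧸ Ideal.span (t '' (S : Set (Fin (m + 1))))) ≃+*
      (Algebra.adjoin A (Set.range z) ⧸ LogChart.nonunitIdeal P φ) :=
    ((Ideal.quotEquivOfEq hker.symm).trans (RingHom.quotientKerEquivOfSurjective hsurj)).trans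
      (Ideal.quotEquivOfEq hIJ.symm)
  -- dimension
  haveI : Algebra.IsIntegral A (Algebra.adjoin A (Set.range z)) :=
    Algebra.IsIntegral.adjoin fun x hx => by
      obtain ⟨j, rfl⟩ := hx
      obtain ⟨b, hb⟩ := hzp j
      exact IsIntegral.of_pow hp.pos (by rw [hb]; exact isIntegral_algebraMap)
  have hinjR : Function.Injective (algebraMap A (Algebra.adjoin A (Set.range z))) :=
    fun b b' h => hinj (by
      have := congrArg (fun s : Algebra.adjoin A (Set.range z) => (s : L)) h
      simpa using this)
  unfold LogChart.IsLogRegularLocal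
  refine ⟨IsRegularLocalRing.of_ringEquiv e, ?_⟩
  rw [← ringKrullDim_eq_of_ringEquiv e,
    ← Literature.RingTheory.KrullDimension.ringKrullDim_eq_of_isIntegral hinjR, hfin,
    Nat.sub_sub_self ((Finset.card_le_univ S).trans_eq (Fintype.card_fin _)), ← hdim]

end Summit.ResolutionOfSingularities.ResolutionOfSingularities.Theorems.RadicialJung.CleanModelsSuffice
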